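import Summits.Ventures.PercRepro.RankDistUpSet
import Summits.Ventures.PercRepro.RankDistLubellShadow

/-!
# PercRepro — THEOREM P′ SHARPENED BY THE GIRTH: the rank level dominates the size level up to `2u ≤ ρ(E) + girth`
(p9, gen 21)

`RankDistUpSet` proves, for every up-closed family `P` in a finite matroid of rank `p`, `#{A ∈ P : |A| = u} ≤
#{A ∈ P : ρ(A) = u}` for `2u ≤ p`, by the inclusion graph between `L_ν = {|A| = u, ρ(A) = u − ν}` and
`R_ν = {ρ(A') = u, |A'| = u + ν}`: `deg(A) ≥ C(p − u + ν, ν)` and `deg(A') ≤ C(u + ν, ν)`. The second bound is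
crude. A set `A ∈ L_ν` below `A'` is `A' ∖ X` with `X` a `ν`-set of COLOOPS of `M|A'` (`sdiff_subset_coloopsIn`:
removing `X` lowers the rank by `|X|`, so every element of `X` lowers it by one). When `ν ≥ 1` the set `A'` is
dependent and contains a circuit `C₀`; the coloops of `M|A'` avoid `C₀` (`notMem_coloopsIn_of_mem_circuit`) and add
rank on top of it (`rk_union_subset_coloopsIn`), so `#coloops(M|A') + |C₀| ≤ u + 1` — with GIRTH `≥ g` (every
circuit has at least `g` elements) `#coloops(M|A') + g ≤ u + 1` (`ncard_coloopsIn_add_le`) and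
`deg(A') ≤ C(u + 1 − g, ν)` (`card_bipartiteBelow_upSizeLevNull_le_of_girth`). Hence
**`|L_ν| ≤ |R_ν|` for `ν ≥ 1` and `2u + 1 ≤ p + g + ν`** (`card_upSizeLevNull_le_card_upRankLevNull_of_girth`;
`ν = 0` is an equality of families) and
**`#{A ∈ P : |A| = u} ≤ #{A ∈ P : ρ(A) = u}` for every `u ≤ p` with `2u ≤ p + g`**
(`card_upSizeLev_le_card_upRankLev_of_girth`); with `P = ⊤`, **`C(n, u) ≤ c_u` for `2u ≤ ρ(E) + girth`**
(`choose_le_levelCount_of_girth`). Every matroid has girth `≥ 1` (`2u ≤ p + 1`), loopless ones `≥ 2`, simple ones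
`≥ 3`; the range is sharp: the power set of `[I₆ | e₁ + e₂]` (`n = 7`, `p = 6`, `g = 3`) has `C(7, 5) = 21 > c₅ = 19`
at `2u = 10 = p + g + 1`. On the tight layer (`sizeLev` / `shadowLev` are the size / rank levels of the up-set of
the bottom sets, `sizeLev_eq_upSizeLev`, `shadowLev_eq_upRankLev`) this gives Theorem P up to `2u ≤ p + g`
(`card_sizeLev_le_card_shadowLev_of_girth`), the weak cumulative inequality `#𝓑·C(n, u) ≤ s_u·C(n, q)` there
(`card_Uq_mul_choose_le_card_shadowLev_mul_choose_of_girth`), and — every circuit having `≥ q + 2` elements, which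
also closes the bottom sets — **the row C-048 itself for every `q ≤ u ≤ p` with `2u ≤ n + 2`**
(`shadowCumulative_of_circuits_of_le`). Nothing here moves any window of the crux.
-/

namespace PercRepro.RankDist

open Set Finset _root_.Matroid PercRepro.ThmH

variable {α : Type} (M : Matroid α) [M.Finite]

/-! ## The rank of `insert x X` -/

/-- `x ∈ E`, `x ∉ cl(X)`: `ρ(X ∪ x) = ρ(X) + 1` (set form). -/
lemma rk_insert_of_notMem_closure_set {x : α} (hx : x ∈ M.E) {X : Set α} (hX : X ⊆ M.E)
    (hxX : x ∉ M.closure X) : rk M (insert x X) = rk M X + 1 := by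
  have h := Matroid.eRk_insert_eq_add_one (M := M) (e := x) (X := X) ⟨hx, hxX⟩
  unfold rk
  rw [h, eRk_eq_coe_rk M hX, ENat.toNat_coe, ← Nat.cast_one, ← Nat.cast_add, ENat.toNat_coe]

omit [M.Finite] in
/-- `x ∈ cl(X)`: `ρ(X ∪ x) = ρ(X)` (set form). -/
lemma rk_insert_of_mem_closure_set {x : α} {X : Set α} (hxX : x ∈ M.closure X) :
    rk M (insert x X) = rk M X := by
  unfold rk
  rw [← Matroid.eRk_closure_eq M (insert x X), Matroid.closure_insert_eq_of_mem_closure hxX,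
    Matroid.eRk_closure_eq]

/-- `ρ(X) ≤ ρ(X ∖ x) + 1`. -/
lemma rk_le_rk_sdiff_singleton_add_one {x : α} {X : Set α} (hX : X ⊆ M.E) (hx : x ∈ X) :
    rk M X ≤ rk M (X \ {x}) + 1 := by
  have h := Matroid.eRk_insert_le_add_one M x (X \ {x})
  rw [Set.insert_sdiff_singleton, Set.insert_eq_of_mem hx, eRk_eq_coe_rk M hX,
    eRk_eq_coe_rk M (Set.sdiff_subset.trans hX)] at h
  exact_mod_cast h

/-- `ρ(X) ≤ ρ(Y) + |X ∖ Y|` for `Y ⊆ X ⊆ E`. -/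
lemma rk_le_rk_add_ncard_sdiff {X Y : Set α} (hX : X ⊆ M.E) (hYX : Y ⊆ X) :
    rk M X ≤ rk M Y + (X \ Y).ncard := by
  have hfin : (X \ Y).Finite := M.ground_finite.subset (Set.sdiff_subset.trans hX)
  have h1 := Matroid.eRk_union_le_eRk_add_eRk M Y (X \ Y)
  have h2 := Matroid.eRk_le_encard M (X \ Y)
  rw [Set.union_sdiff_cancel hYX, eRk_eq_coe_rk M hX, eRk_eq_coe_rk M (hYX.trans hX)] at h1
  rw [hfin.encard_eq_coe_toFinset_card, ← Set.ncard_eq_toFinset_card _ hfin] at h2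
  have h3 : (rk M X : ℕ∞) ≤ ((rk M Y + (X \ Y).ncard : ℕ) : ℕ∞) := by
    rw [Nat.cast_add]
    exact h1.trans (add_le_add le_rfl h2)
  exact_mod_cast h3

/-! ## The coloops of `M|A'` -/

/-- The coloops of `M|A'`: the elements of `A'` whose removal lowers the rank. -/
def coloopsIn (A' : Set α) : Set α := {x ∈ A' | rk M (A' \ {x}) + 1 = rk M A'}

omit [M.Finite] in
/-- A coloop of `M|A'` is outside the closure of `A' ∖ x`. -/
lemma notMem_closure_sdiff_of_mem_coloopsIn {A' : Set α} {x : α}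
    (hx : x ∈ coloopsIn M A') : x ∉ M.closure (A' \ {x}) := by
  intro hcl
  have h := rk_insert_of_mem_closure_set M hcl
  rw [Set.insert_sdiff_singleton, Set.insert_eq_of_mem hx.1] at h
  have := hx.2
  omega

/-- **Removing `ν` elements from `A'` and lowering the rank by `ν` removes coloops only**: if `t ⊆ A'`,
`|t| = u`, `ρ(t) = u − ν`, `|A'| = u + ν`, `ρ(A') = u`, then `A' ∖ t ⊆ coloops(M|A')`. -/
lemma sdiff_subset_coloopsIn {A' t : Set α} (hA' : A' ⊆ M.E) (htA : t ⊆ A') {u ν : ℕ} (hν : 1 ≤ ν)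
    (htu : t.ncard = u) (htrk : rk M t + ν = u) (hA'card : A'.ncard = u + ν) (hA'rk : rk M A' = u) :
    A' \ t ⊆ coloopsIn M A' := by
  intro x hx
  have hfinA : A'.Finite := M.ground_finite.subset hA'
  refine ⟨hx.1, ?_⟩
  -- `ρ(A' ∖ x) ≤ ρ(t) + |(A' ∖ x) ∖ t| = (u − ν) + (ν − 1)`
  have htsub : t ⊆ A' \ {x} := fun y hy => ⟨htA hy, fun h => hx.2 (Set.mem_singleton_iff.1 h ▸ hy)⟩
  have h1 := rk_le_rk_add_ncard_sdiff M (Set.sdiff_subset.trans hA') htsub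
  have hc1 : (A' \ {x}).ncard = u + ν - 1 := by
    rw [Set.ncard_sdiff' (Set.singleton_subset_iff.2 hx.1) hfinA, Set.ncard_singleton, hA'card]
  have hc2 : ((A' \ {x}) \ t).ncard = u + ν - 1 - u := by
    rw [Set.ncard_sdiff' htsub (hfinA.subset Set.sdiff_subset), hc1, htu]
  -- `ρ(A') ≤ ρ(A' ∖ x) + 1`
  have h2 := rk_le_rk_sdiff_singleton_add_one M hA' hx.1
  rw [hc2] at h1
  omega

omit [M.Finite] in
/-- The coloops of `M|A'` avoid every circuit inside `A'`. -/
lemma notMem_coloopsIn_of_mem_circuit {A' C : Set α} (hC : M.IsCircuit C) (hCA : C ⊆ A')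
    {x : α} (hxC : x ∈ C) : x ∉ coloopsIn M A' := by
  intro hx
  refine notMem_closure_sdiff_of_mem_coloopsIn M hx ?_
  exact M.closure_subset_closure (Set.sdiff_subset_sdiff_left hCA) (hC.mem_closure_sdiff_singleton_of_mem hxC)

/-- **The coloops add rank on top of a circuit**: for a circuit `C ⊆ A'` and `S ⊆ coloops(M|A')`,
`ρ(C ∪ S) = ρ(C) + |S|`. -/
lemma rk_union_subset_coloopsIn {A' C : Set α} (hA' : A' ⊆ M.E) (hC : M.IsCircuit C) (hCA : C ⊆ A')
    {S : Set α} (hS : S ⊆ coloopsIn M A') : rk M (C ∪ S) = rk M C + S.ncard := by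
  have hfinS : S.Finite := M.ground_finite.subset (hS.trans (fun y hy => hA' hy.1))
  refine Set.Finite.induction_on_subset (motive := fun T _ => rk M (C ∪ T) = rk M C + T.ncard) S hfinS ?_ ?_
  · simp
  · intro a T haS hTS haT ih
    have hT : T ⊆ coloopsIn M A' := hTS.trans hS
    have ha : a ∈ coloopsIn M A' := hS haS
    have haC : a ∉ C := fun h => notMem_coloopsIn_of_mem_circuit M hC hCA h ha
    have hsub : C ∪ T ⊆ A' \ {a} := by
      intro y hy
      rcases hy with hy | hy
      · exact ⟨hCA hy, fun h => haC (by rw [← Set.mem_singleton_iff.1 h]; exact hy)⟩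
      · exact ⟨(hT hy).1, fun h => haT (by rw [← Set.mem_singleton_iff.1 h]; exact hy)⟩
    have hacl : a ∉ M.closure (C ∪ T) := fun h =>
      notMem_closure_sdiff_of_mem_coloopsIn M ha (M.closure_subset_closure hsub h)
    have hCT : C ∪ T ⊆ M.E := Set.union_subset (hCA.trans hA') (fun y hy => hA' (hT hy).1)
    rw [Set.union_insert, rk_insert_of_notMem_closure_set M (hA' ha.1) hCT hacl, ih,
      Set.ncard_insert_of_notMem haT (M.ground_finite.subset (fun y hy => hA' (hT hy).1))]
    ring

/-- **The coloops of a dependent `A'` of rank `u` number at most `u + 1 − girth`**: if every circuit has at least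
`g` elements, `|A'| = u + ν` with `ν ≥ 1` and `ρ(A') = u`, then `#coloops(M|A') + g ≤ u + 1`. -/
lemma ncard_coloopsIn_add_le {g : ℕ} (hg : ∀ C, M.IsCircuit C → (g : ℕ∞) ≤ C.encard) {A' : Set α}
    (hA' : A' ⊆ M.E) {u ν : ℕ} (hν : 1 ≤ ν) (hA'card : A'.ncard = u + ν) (hA'rk : rk M A' = u) :
    (coloopsIn M A').ncard + g ≤ u + 1 := by
  have hfinA : A'.Finite := M.ground_finite.subset hA'
  -- `A'` is dependent: a circuit `C ⊆ A'`
  have hdep : M.Dep A' := by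
    rw [Matroid.dep_iff]
    refine ⟨fun hind => ?_, hA'⟩
    have h := hind.eRk_eq_encard
    rw [eRk_eq_coe_rk M hA', hfinA.encard_eq_coe_toFinset_card, ← Set.ncard_eq_toFinset_card _ hfinA,
      hA'rk, hA'card] at h
    have h' : u = u + ν := by exact_mod_cast h
    omega
  obtain ⟨C, hCA, hC⟩ := hdep.exists_isCircuit_subset
  have hCE : C ⊆ M.E := hCA.trans hA'
  have hfinC : C.Finite := hfinA.subset hCA
  -- `ρ(C) + 1 = |C| ≥ g`
  have hCrk : rk M C + 1 = C.ncard := by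
    have h := hC.eRk_add_one_eq
    rw [eRk_eq_coe_rk M hCE, hfinC.encard_eq_coe_toFinset_card, ← Set.ncard_eq_toFinset_card _ hfinC] at h
    exact_mod_cast h
  have hgC : g ≤ C.ncard := by
    have h := hg C hC
    rw [hfinC.encard_eq_coe_toFinset_card, ← Set.ncard_eq_toFinset_card _ hfinC] at h
    exact_mod_cast h
  -- `ρ(C ∪ coloops) = ρ(C) + #coloops ≤ ρ(A') = u`
  have hcol : coloopsIn M A' ⊆ A' := fun x hx => hx.1
  have h1 := rk_union_subset_coloopsIn M hA' hC hCA (subset_refl (coloopsIn M A'))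
  have h2 := rk_mono_of_subset M (Set.union_subset hCA hcol) hA'
  rw [h1, hA'rk] at h2
  omega

/-! ## The sharpened degree bound and the stratified theorem -/

open scoped Classical in
/-- **Every `A'` of rank `u` and size `u + ν`, `ν ≥ 1`, lies above at most `C(u + 1 − g, ν)` sets of size `u`**
when every circuit has at least `g` elements: the sets below are `A' ∖ X` with `X` a `ν`-set of coloops. -/
lemma card_bipartiteBelow_upSizeLevNull_le_of_girth {P : Set α → Prop} {g : ℕ}
    (hg : ∀ C, M.IsCircuit C → (g : ℕ∞) ≤ C.encard) {u ν : ℕ} (hν : 1 ≤ ν) {A' : Set α}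
    (hA' : A' ∈ upRankLevNull M P u ν) :
    ((upSizeLevNull M P u ν).bipartiteBelow (fun A A' => A ⊆ A') A').card ≤ (u + 1 - g).choose ν := by
  obtain ⟨hA', hA'card⟩ := (mem_upRankLevNull M).1 hA'
  obtain ⟨hA'E, -, hA'rk⟩ := (mem_upRankLev M).1 hA'
  have hfin : A'.Finite := M.ground_finite.subset hA'E
  have hfincol : (coloopsIn M A').Finite := hfin.subset fun x hx => hx.1
  -- the family below `A'`, as a set of sets
  set T : Set (Set α) := {t | t ⊆ A' ∧ t.ncard = u ∧ rk M t + ν = u} with hT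
  have hsub : (((upSizeLevNull M P u ν).bipartiteBelow (fun A A' => A ⊆ A') A' : Finset (Set α)) :
      Set (Set α)) ⊆ T := by
    intro A hA
    rw [Finset.mem_coe, Finset.bipartiteBelow, Finset.mem_filter, mem_upSizeLevNull, mem_upSizeLev] at hA
    exact ⟨hA.2, hA.1.1.2.2, hA.1.2⟩
  -- `t ↦ A' ∖ t` injects `T` into the `ν`-subsets of the coloops
  have hinj : T.ncard ≤ {X | X ⊆ coloopsIn M A' ∧ X.ncard = ν}.ncard := by
    refine Set.ncard_le_ncard_of_injOn (fun t => A' \ t) (fun t ht => ?_) (fun t₁ ht₁ t₂ ht₂ h => ?_)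
      (hfincol.finite_subsets.subset fun X hX => hX.1)
    · obtain ⟨htA, htu, htrk⟩ := ht
      refine ⟨sdiff_subset_coloopsIn M hA'E htA hν htu htrk hA'card hA'rk, ?_⟩
      rw [Set.ncard_sdiff' htA hfin, hA'card, htu]
      omega
    · have h1 := congrArg (fun X => A' \ X) h
      simp only [Set.sdiff_sdiff_cancel_left ht₁.1, Set.sdiff_sdiff_cancel_left ht₂.1] at h1
      exact h1
  have hpow := Set.ncard_powerset_ncard hfincol ν
  have hcol := ncard_coloopsIn_add_le M hg hA'E hν hA'card hA'rk
  have hfinT : T.Finite := hfin.finite_subsets.subset fun t ht => ht.1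
  have h1 := Set.ncard_le_ncard hsub hfinT
  rw [Set.ncard_coe_finset] at h1
  calc ((upSizeLevNull M P u ν).bipartiteBelow (fun A A' => A ⊆ A') A').card
      ≤ T.ncard := h1
    _ ≤ {X | X ⊆ coloopsIn M A' ∧ X.ncard = ν}.ncard := hinj
    _ = (coloopsIn M A').ncard.choose ν := hpow
    _ ≤ (u + 1 - g).choose ν := Nat.choose_le_choose ν (by omega)

/-- **THEOREM P′ FOR AN UP-SET, STRATIFIED AND SHARPENED BY THE GIRTH**: `|L_ν| ≤ |R_ν|` for `1 ≤ ν ≤ u ≤ p` and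
`2u + 1 ≤ p + g + ν`, when every circuit has at least `g` elements. -/
theorem card_upSizeLevNull_le_card_upRankLevNull_of_girth {P : Set α → Prop} (hP : UpClosed M P) {p g u ν : ℕ}
    (hr : M.eRank = (p : ℕ∞)) (hg : ∀ C, M.IsCircuit C → (g : ℕ∞) ≤ C.encard) (hν : 1 ≤ ν) (hνu : ν ≤ u)
    (hup : u ≤ p) (hu : 2 * u + 1 ≤ p + g + ν) :
    (upSizeLevNull M P u ν).card ≤ (upRankLevNull M P u ν).card := by
  classical
  have hdc := Finset.card_mul_le_card_mul (s := upSizeLevNull M P u ν) (t := upRankLevNull M P u ν)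
    (fun A A' => A ⊆ A') (fun A hA => card_bipartiteAbove_upRankLevNull_ge M hP hr hνu hup hA)
    (fun A' hA' => card_bipartiteBelow_upSizeLevNull_le_of_girth M hg hν hA')
  have hch : (u + 1 - g).choose ν ≤ (p - u + ν).choose ν := Nat.choose_le_choose ν (by omega)
  have hpos : 0 < (p - u + ν).choose ν := Nat.choose_pos (by omega)
  have h : (upSizeLevNull M P u ν).card * (p - u + ν).choose ν
      ≤ (upRankLevNull M P u ν).card * (p - u + ν).choose ν :=
    hdc.trans (Nat.mul_le_mul_left _ hch)
  exact Nat.le_of_mul_le_mul_right h hpos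

/-- At nullity `0` the two families coincide: `L_0 ⊆ R_0`. -/
lemma upSizeLevNull_zero_subset (P : Set α → Prop) (u : ℕ) :
    upSizeLevNull M P u 0 ⊆ upRankLevNull M P u 0 := by
  classical
  intro A hA
  rw [mem_upSizeLevNull, mem_upSizeLev] at hA
  rw [mem_upRankLevNull, mem_upRankLev]
  obtain ⟨⟨hAE, hPA, hAu⟩, hrk⟩ := hA
  exact ⟨⟨hAE, hPA, by omega⟩, by omega⟩

/-- **THEOREM P′ SHARPENED BY THE GIRTH**: in a finite matroid of rank `p` in which every circuit has at least `g`
elements, for every up-closed predicate `P` and every `u ≤ p` with `2u ≤ p + g`, the members of the up-set with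
exactly `u` elements are at most its members of rank `u`. -/
theorem card_upSizeLev_le_card_upRankLev_of_girth {P : Set α → Prop} (hP : UpClosed M P) {p g u : ℕ}
    (hr : M.eRank = (p : ℕ∞)) (hg : ∀ C, M.IsCircuit C → (g : ℕ∞) ≤ C.encard) (hup : u ≤ p)
    (hu : 2 * u ≤ p + g) : (upSizeLev M P u).card ≤ (upRankLev M P u).card := by
  rw [card_upSizeLev_eq_sum]
  refine (Finset.sum_le_sum fun ν hν => ?_).trans (sum_card_upRankLevNull_le M P u _)
  rw [Finset.mem_range] at hν
  rcases Nat.eq_zero_or_pos ν with h0 | hpos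
  · rw [h0]
    exact Finset.card_le_card (upSizeLevNull_zero_subset M P u)
  · exact card_upSizeLevNull_le_card_upRankLevNull_of_girth M hP hr hg hpos (by omega) hup (by omega)

/-- **The rank distribution dominates the binomial coefficients up to `2u ≤ ρ(E) + girth`**: if every circuit has
at least `g` elements, `C(|E|, u) ≤ c_u = #{A ⊆ E : ρ(A) = u}` for every `u ≤ ρ(E)` with `2u ≤ ρ(E) + g`. Sharp:
`[I₆ | e₁ + e₂]` (`n = 7`, `p = 6`, `g = 3`) has `C(7, 5) = 21 > c₅ = 19` at `2u = p + g + 1`. -/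
theorem choose_le_levelCount_of_girth {p g u : ℕ} (hr : M.eRank = (p : ℕ∞))
    (hg : ∀ C, M.IsCircuit C → (g : ℕ∞) ≤ C.encard) (hup : u ≤ p) (hu : 2 * u ≤ p + g) :
    ((gr M).card).choose u ≤ levelCount M u := by
  classical
  have hP : UpClosed M (fun _ => True) := fun _ _ _ _ _ => trivial
  have h := card_upSizeLev_le_card_upRankLev_of_girth M hP hr hg hup hu
  rw [card_upSizeLev_true, card_upRankLev_true] at h
  exact h

/-! ## The tight layer: Theorem P and the row C-048 up to `2u ≤ p + girth` -/

section Tight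

variable [DecidableEq α]

/-- The size level of the up-set of the bottom sets is the size level of the up-closed predicate
`A ⊇ some bottom set`. -/
lemma sizeLev_eq_upSizeLev (p q k : ℕ) :
    sizeLev M p q k = upSizeLev M (fun A => ∃ B ∈ PerFlat.Uq M p q, (B : Set α) ⊆ A) k := by
  classical
  ext A
  rw [mem_sizeLev, mem_upSizeLev]
  tauto

/-- The shadow at level `u` is the rank level of the same predicate. -/
lemma shadowLev_eq_upRankLev (p q u : ℕ) :
    shadowLev M u (PerFlat.Uq M p q) = upRankLev M (fun A => ∃ B ∈ PerFlat.Uq M p q, (B : Set α) ⊆ A) u := by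
  classical
  ext A
  rw [mem_shadowLev, mem_upRankLev]
  tauto

/-- The predicate `A ⊇ some bottom set` is up-closed. -/
lemma upClosed_containsBottomSet (p q : ℕ) :
    UpClosed M (fun A => ∃ B ∈ PerFlat.Uq M p q, (B : Set α) ⊆ A) := by
  intro A A' _ hAA' ⟨B, hB, hBA⟩
  exact ⟨B, hB, hBA.trans hAA'⟩

/-- **THEOREM P UP TO `2u ≤ p + girth`** (tight layer): `U_u ≤ s_u` for every `u ≤ p` with `2u ≤ p + g` when every
circuit has at least `g` elements. -/
theorem card_sizeLev_le_card_shadowLev_of_girth {p q g u : ℕ} (hr : M.eRank = (p : ℕ∞))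
    (hg : ∀ C, M.IsCircuit C → (g : ℕ∞) ≤ C.encard) (hup : u ≤ p) (hu : 2 * u ≤ p + g) :
    (sizeLev M p q u).card ≤ (shadowLev M u (PerFlat.Uq M p q)).card := by
  rw [sizeLev_eq_upSizeLev, shadowLev_eq_upRankLev]
  exact card_upSizeLev_le_card_upRankLev_of_girth M (upClosed_containsBottomSet M p q) hr hg hup hu

/-- **The weak cumulative inequality up to `2u ≤ p + girth`**: `#𝓑·C(p+q, u) ≤ s_u·C(p+q, q)` for `q ≤ u ≤ p`
with `2u ≤ p + g` when every circuit has at least `g` elements. -/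
theorem card_Uq_mul_choose_le_card_shadowLev_mul_choose_of_girth {p q g u : ℕ} (hn : (gr M).card = p + q)
    (hr : M.eRank = (p : ℕ∞)) (hg : ∀ C, M.IsCircuit C → (g : ℕ∞) ≤ C.encard) (hqu : q ≤ u) (hup : u ≤ p)
    (hu : 2 * u ≤ p + g) :
    (PerFlat.Uq M p q).card * (p + q).choose u ≤ (shadowLev M u (PerFlat.Uq M p q)).card * (p + q).choose q := by
  have h1 := card_sizeLev_mul_choose_le M p q hqu
  rw [hn, card_sizeLev_q M hn hr] at h1
  exact h1.trans (Nat.mul_le_mul_right _ (card_sizeLev_le_card_shadowLev_of_girth M hr hg hup hu))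

/-- **C-048 ON THE TIGHT LAYER FOR `2u ≤ n + 2` WHEN EVERY CIRCUIT HAS AT LEAST `q + 2` ELEMENTS**: then the bottom
sets are closed (`s_q = #𝓑`) and the girth is `≥ q + 2`, so `s_q·C(p+q, u) ≤ s_u·C(p+q, q)` for every
`q ≤ u ≤ p` with `2u ≤ p + q + 2`. -/
theorem shadowCumulative_of_circuits_of_le {p q u : ℕ} (hn : (gr M).card = p + q) (hr : M.eRank = (p : ℕ∞))
    (hcirc : ∀ C, M.IsCircuit C → ((q + 2 : ℕ) : ℕ∞) ≤ C.encard) (hqu : q ≤ u) (hup : u ≤ p)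
    (hu : 2 * u ≤ p + q + 2) :
    (shadowLev M q (PerFlat.Uq M p q)).card * (p + q).choose u
      ≤ (shadowLev M u (PerFlat.Uq M p q)).card * (p + q).choose q :=
  (Nat.mul_le_mul_right _ (card_shadowLev_q_le_of_closed M hn hr (closure_Uq_eq_self_of_circuits M hn hr hcirc))).trans
    (card_Uq_mul_choose_le_card_shadowLev_mul_choose_of_girth M hn hr hcirc hqu hup (by omega))

end Tight

end PercRepro.RankDist
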